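import Literature.Analysis.FluidPDE.Ferrari1993CommutatorTermBounds
import Literature.Analysis.FluidPDE.ConvectCommutatorCalculus
import HarnessLib

/-!
# Discharge of `Ferrari1993_periodicCylinderCommutatorEstimate` (Ferrari 1993, Lemma 1 (ii), `s = 3`)

Topic `Literature/Analysis/FluidPDE`. We **prove** the named fact
`Literature.Analysis.FluidPDE.Ferrari1993_periodicCylinderCommutatorEstimate`
(`Ferrari1993EnergyInequalityReduction.lean`; A. B. Ferrari, Comm. Math. Phys. **155** (1993), the
display following Lemma 1, p. 280: `‖u·D^α∇u − D^α(u·∇u)‖_{L²(Ω)} ≤ C |u|_{H^s} |u|_{W^{1,∞}}`,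
`|α| ≤ s = 3`, rendered on the period cell of the periodic cylinder with ordered word derivatives):

`Ferrari1993_periodicCylinderCommutatorEstimate_holds`.

Proof: for a word `w` of length `m ≤ 3` the commutator `[D_w, v·∇]v` (`convectionCommutator m w v`,
definitionally `convectCommutator m (sobolevDir w) v v`) is unrolled by the Leibniz recursion
`convectCommutator_succ_eqOn` (`ConvectCommutatorCalculus.lean`) into `0, 1, 3, 7` convective
products `(D_β v·∇) D_γ v` (`β ≠ ∅`) on the open cylinder; each is bounded in `L²(cell)` by
`C ‖v‖_{W^{1,∞}(cell)} ‖v‖_{H³(cell)}` by the term bounds of `Ferrari1993CommutatorTermBounds.lean`: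
type I (`|β| = 1`: `sup |∂v| × ‖D D_γ v‖_{L²}`), type III (`γ = ∅`: `sup |Dv| × ‖D_β v‖_{L²}`) and
type II (`|β| = 2`, `|γ| = 1`: the Nirenberg `L⁴` inequality on the cell,
`PeriodicCylinderGagliardoNirenberg.lean`), the sup being read off `‖v‖_{W^{1,∞}(cell)}`
(`norm_le_of_eLpNorm_top_of_continuousOn`) and the `L²` norms of word derivatives off
`‖v‖_{H³(cell)}` (`eSobolevDomainNorm_eq_sum_iterDeriv`). This is the direct proof of the applied
estimate, by integration by parts with the wall term on the cell instead of Ferrari's route through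
extension operators and the free-space Moser inequalities; that route is in the tree as well
(`Ferrari1993CommutatorFromMoser.lean`, `Ferrari1993MoserInequality.lean`), where the fact is
discharged under the primed name `Ferrari1993_periodicCylinderCommutatorEstimate_holds'`, the
unprimed name being left to the present direct proof. The two discharges are independent; all
consumers (`Ferrari1993_periodicCylinderHsEnergyInequality_holds`,
`Ferrari1993HsEnergyInequalityHolds.lean`) are already served by the primed one, so nothing
downstream changes.
-/

noncomputable section

open MeasureTheory Set Function Filter Topology TopologicalSpace WithLp Real
open scoped ContDiff NNReal ENNReal InnerProductSpace RealInnerProductSpace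

namespace Literature.Analysis.FluidPDE

open Literature.Analysis.FunctionSpaces

/-- Abbreviation inside this file: the dimension index of the tree's basis of `ℝ³`. -/
local notation "𝔡" => Module.finrank ℝ (EuclideanSpace ℝ (Fin 3))
/-- Abbreviation inside this file: the tree's basis of `ℝ³`. -/
local notation "𝔢" => Module.finBasis ℝ (EuclideanSpace ℝ (Fin 3))
/-- Abbreviation inside this file: physical space. -/
local notation "E³" => EuclideanSpace ℝ (Fin 3)

/-! ### Small tools -/

/-- `eLpNorm` of a function from an a.e. equality on the cell with a pointwise identity on the open
cylinder. [folklore] -/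
theorem eLpNorm_cylinderCell_congr {F' : Type*} [NormedAddCommGroup F'] {L : ℝ} {f g : E³ → F'}
    (h : EqOn f g (unitCylinder : Set E³)) (p : ℝ≥0∞) :
    eLpNorm f p (volume.restrict (cylinderCell L : Set E³)) =
      eLpNorm g p (volume.restrict (cylinderCell L : Set E³)) :=
  eLpNorm_congr_ae (ae_restrict_of_forall_mem (cylinderCell L).isOpen.measurableSet fun _ hx =>
    h (cylinderCell_le_unitCylinder L hx))

/-- `convect a b` is continuous on the open cylinder for `a, b` smooth there. [folklore] -/
theorem continuousOn_convect {a b : E³ → E³} (ha : ContDiffOn ℝ ∞ a (unitCylinder : Set E³))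
    (hb : ContDiffOn ℝ ∞ b (unitCylinder : Set E³)) : ContinuousOn (convect a b) (unitCylinder : Set E³) :=
  (contDiffOn_convect_of_isOpen' unitCylinder.isOpen ha hb).continuousOn

/-- `ofReal (c · N.toReal) ≤ ofReal c · N`. [folklore] -/
theorem ofReal_mul_toReal_le {c : ℝ} (hc : 0 ≤ c) (N : ℝ≥0∞) :
    ENNReal.ofReal (c * N.toReal) ≤ ENNReal.ofReal c * N := by
  rw [ENNReal.ofReal_mul hc]
  exact mul_le_mul_of_nonneg_left ENNReal.ofReal_toReal_le (zero_le)

/-- From a real bound on `∫ ‖S‖²` to a bound on `‖S‖_{L²}` for `S ∈ L²`. [folklore] -/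
theorem eLpNorm_two_le_ofReal_of_integral_sq_le {L : ℝ} {S : E³ → E³}
    (hS : MemLp S 2 (volume.restrict (cylinderCell L : Set E³))) {b : ℝ} (hb : 0 ≤ b)
    (h : ∫ x in (cylinderCell L : Set E³), ‖S x‖ ^ 2 ≤ b ^ 2) :
    eLpNorm S 2 (volume.restrict (cylinderCell L : Set E³)) ≤ ENNReal.ofReal b := by
  rw [integral_norm_sq_eq_toReal_eLpNorm_two_sq hS] at h
  have h1 : (eLpNorm S 2 (volume.restrict (cylinderCell L : Set E³))).toReal ≤ b :=
    (pow_le_pow_iff_left₀ ENNReal.toReal_nonneg hb two_ne_zero).1 h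
  exact (ENNReal.le_ofReal_iff_toReal_le hS.eLpNorm_ne_top hb).2 h1

/-! ### The discharge -/

/-- **Discharge of `Ferrari1993_periodicCylinderCommutatorEstimate`** (Ferrari 1993, the display
following Lemma 1, p. 280, `‖u·D^α∇u − D^α(u·∇u)‖_{L²} ≤ C |u|_{H^s} |u|_{W^{1,∞}}` for `|α| ≤ s = 3`,
on the period cell of the periodic cylinder with ordered word derivatives): for `L > 0` there is
`C` with `‖[D_w, v·∇]v‖_{L²(cell)} ≤ C ‖v‖_{W^{1,∞}(cell)} ‖v‖_{H³(cell)}` for every `v` smooth on the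
closed cylinder and `L`-periodic and every word `w` of length `≤ 3` in the basis. Leibniz recursion
of the word commutator, then the type I/II/III term bounds (the type II products through the
Nirenberg `L⁴` inequality on the cell). [cite: Ferrari1993, Lemma 1 (ii) and the display following it, p. 280] -/
theorem Ferrari1993_periodicCylinderCommutatorEstimate_holds :
    Ferrari1993_periodicCylinderCommutatorEstimate := by
  intro L hL
  obtain ⟨C_b, -, hCb⟩ := exists_opNorm_le_mul_sum_basis (F := E³) 𝔢
  obtain ⟨K, hK0, hK⟩ := exists_integral_norm_sq_convect_two_one_le hL
  set Kn : ℝ≥0 := ⟨K, hK0⟩ with hKn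
  refine ⟨4 * C_b * (𝔡 : ℝ≥0) + 3 * Kn + 1, fun v hv hper m hm w => ?_⟩
  -- the setting
  set Kc : Set E³ := closure (unitCylinder : Set E³) with hKc
  set U : Set E³ := (unitCylinder : Set E³) with hU_def
  set Ω : Set E³ := (cylinderCell L : Set E³) with hΩ
  set μ : Measure E³ := volume.restrict Ω with hμ
  have hU : IsOpen U := unitCylinder.isOpen
  have hΩU : Ω ⊆ U := cylinderCell_le_unitCylinder L
  have hΩK : Ω ⊆ Kc := hΩU.trans subset_closure
  have hΩo : IsOpen Ω := (cylinderCell L).isOpen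
  have hΩm : MeasurableSet Ω := hΩo.measurableSet
  have hKu : UniqueDiffOn ℝ Kc := uniqueDiffOn_closure_unitCylinder
  have hUK : ∀ x ∈ U, Kc ∈ 𝓝 x := fun x hx => closure_unitCylinder_mem_nhds hx
  have hvU : ContDiffOn ℝ ∞ v U := hv.mono subset_closure
  have hvΩ : ContDiffOn ℝ ∞ v Ω := hv.mono hΩK
  -- the two norms are finite
  set N₁ := eSobolevDomainNorm 1 ∞ (cylinderCell L) volume v with hN₁
  set N₃ := eSobolevDomainNorm 3 2 (cylinderCell L) volume v with hN₃
  have hN₁t : N₁ < ⊤ := eSobolevDomainNorm_cylinderCell_lt_top L 1 ∞ hv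
  have hN₃t : N₃ < ⊤ := eSobolevDomainNorm_cylinderCell_lt_top L 3 2 hv
  set n₁ : ℝ := N₁.toReal with hn₁
  set n₃ : ℝ := N₃.toReal with hn₃
  have hn₁0 : 0 ≤ n₁ := ENNReal.toReal_nonneg
  have hn₃0 : 0 ≤ n₃ := ENNReal.toReal_nonneg
  have hN₁e : ENNReal.ofReal n₁ = N₁ := ENNReal.ofReal_toReal hN₁t.ne
  have hN₃e : ENNReal.ofReal n₃ = N₃ := ENNReal.ofReal_toReal hN₃t.ne
  -- sup bounds on the cell from `N₁`
  have hW : HasWeakFDerivOn (cylinderCell L) volume v (fderiv ℝ v) :=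
    MeyersSerrin.hasWeakFDerivOn_of_contDiffOn hvΩ
  have hN₁eq : N₁ = eLpNorm v ∞ μ + ∑ i, eLpNorm (fun x => fderiv ℝ v x (𝔢 i)) ∞ μ := by
    rw [hN₁, MeyersSerrin.eSobolevDomainNorm_succ_eq hW]
    simp only [eSobolevDomainNorm_zero, hμ, hΩ]
  have hsup1 : ∀ x ∈ Ω, ∀ j, ‖fderiv ℝ v x (𝔢 j)‖ ≤ n₁ := by
    intro x hx j
    have hle : eLpNorm (fun x => fderiv ℝ v x (𝔢 j)) ∞ μ ≤ N₁ := by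
      rw [hN₁eq]
      exact (Finset.single_le_sum (f := fun i => eLpNorm (fun x => fderiv ℝ v x (𝔢 i)) ∞ μ)
        (fun _ _ => zero_le) (Finset.mem_univ j)).trans le_add_self
    exact norm_le_of_eLpNorm_top_of_continuousOn hΩo
      (contDiffOn_fderiv_apply_of_isOpen hΩo hvΩ (𝔢 j)).continuousOn hN₁t.ne hle hx
  -- `L²` bounds of the word derivatives from `N₃`
  have hword : ∀ (k : ℕ) (_ : k ≤ 3) (w' : Fin k → Fin 𝔡),
      ∫ x in Ω, ‖iterDeriv k (fun i => 𝔢 (w' i)) v x‖ ^ 2 ≤ n₃ ^ 2 := fun k hk w' =>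
    integral_norm_sq_iterDeriv_le hvΩ hN₃t.ne le_rfl hk w'
  have hwordE : ∀ (k : ℕ) (_ : k ≤ 3) (w' : Fin k → Fin 𝔡),
      eLpNorm (iterDeriv k (fun i => 𝔢 (w' i)) v) 2 μ ≤ N₃ := fun k hk w' =>
    eLpNorm_iterDeriv_le_eSobolevDomainNorm hvΩ hk w'
  -- smoothness on `U` of the word derivatives (for measurability and the recursion)
  have hsm : ∀ (k : ℕ) (u : Fin k → E³), ContDiffOn ℝ ∞ (iterDeriv k u v) U := fun k u =>
    ContDiffOn.iterDeriv_of_isOpen hU k u hvU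
  have hsm1 : ∀ a : Fin 𝔡, ContDiffOn ℝ ∞ (fun y => fderiv ℝ v y (𝔢 a)) U := fun a =>
    contDiffOn_fderiv_apply_of_isOpen hU hvU (𝔢 a)
  have hsm2 : ∀ a b : Fin 𝔡, ContDiffOn ℝ ∞ (fun x => fderiv ℝ (fun y => fderiv ℝ v y (𝔢 a)) x (𝔢 b)) U :=
    fun a b => contDiffOn_fderiv_apply_of_isOpen hU (hsm1 a) (𝔢 b)
  have hsm3 : ∀ a b c : Fin 𝔡, ContDiffOn ℝ ∞
      (fun x => fderiv ℝ (fun y => fderiv ℝ (fun z => fderiv ℝ v z (𝔢 a)) y (𝔢 b)) x (𝔢 c)) U :=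
    fun a b c => contDiffOn_fderiv_apply_of_isOpen hU (hsm2 a b) (𝔢 c)
  -- identification of the nested derivatives with word derivatives (as functions)
  have e1 : ∀ a : Fin 𝔡, (fun y => fderiv ℝ v y (𝔢 a)) = iterDeriv 1 (fun i => 𝔢 (idxWord₁ a i)) v :=
    fun a => (iterDeriv_idxWord₁ a v).symm
  have e2 : ∀ a b : Fin 𝔡, (fun x => fderiv ℝ (fun y => fderiv ℝ v y (𝔢 a)) x (𝔢 b)) =
      iterDeriv 2 (fun i => 𝔢 (idxWord₂ a b i)) v := fun a b => (iterDeriv_idxWord₂ a b v).symm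
  have e3 : ∀ a b c : Fin 𝔡,
      (fun x => fderiv ℝ (fun y => fderiv ℝ (fun z => fderiv ℝ v z (𝔢 a)) y (𝔢 b)) x (𝔢 c)) =
      iterDeriv 3 (fun i => 𝔢 (idxWord₃ a b c i)) v := fun a b c => by
    rw [iterDeriv_idxWord₃, iterDeriv_idxWord₂]
  -- `∂ⱼ` of a word derivative of length `k` is a word derivative of length `k + 1`
  have esnoc : ∀ (k : ℕ) (w' : Fin k → Fin 𝔡) (j : Fin 𝔡),
      (fun x => fderiv ℝ (iterDeriv k (fun i => 𝔢 (w' i)) v) x (𝔢 j)) =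
        iterDeriv (k + 1) (fun i => 𝔢 ((Fin.snoc w' j : Fin (k + 1) → Fin 𝔡) i)) v := by
    intro k w' j
    rw [show (fun i => 𝔢 ((Fin.snoc w' j : Fin (k + 1) → Fin 𝔡) i)) = Fin.snoc (fun i => 𝔢 (w' i)) (𝔢 j)
      from Fin.comp_snoc 𝔢 w' j, iterDeriv_snoc]
  -- TYPE I bound: `A = ∂ₐ v`, `B = D_{w'} v`, `|w'| = k ≤ 2`
  have typeI : ∀ (a : Fin 𝔡) (k : ℕ) (hk : k ≤ 2) (w' : Fin k → Fin 𝔡),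
      eLpNorm (convect (fun y => fderiv ℝ v y (𝔢 a)) (iterDeriv k (fun i => 𝔢 (w' i)) v)) 2 μ ≤
        (C_b * 𝔡 : ℝ≥0∞) * N₁ * N₃ := by
    intro a k hk w'
    have hB : ∀ j, ContinuousOn (fun x => fderiv ℝ (iterDeriv k (fun i => 𝔢 (w' i)) v) x (𝔢 j)) Ω := fun j =>
      (contDiffOn_fderiv_apply_of_isOpen hU (hsm k _) (𝔢 j)).continuousOn.mono hΩU
    have h := eLpNorm_convect_le_of_norm_le (L := L) hCb (fun x hx => hsup1 x hx a) hB
    refine h.trans ?_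
    have hsum : ∑ j, eLpNorm (fun x => fderiv ℝ (iterDeriv k (fun i => 𝔢 (w' i)) v) x (𝔢 j)) 2 μ ≤
        ∑ _j : Fin 𝔡, N₃ := Finset.sum_le_sum fun j _ => by
      rw [esnoc k w' j]
      exact hwordE (k + 1) (by omega) _
    rw [Finset.sum_const, Finset.card_univ, Fintype.card_fin, nsmul_eq_mul] at hsum
    calc ENNReal.ofReal (n₁ * C_b) * ∑ j, eLpNorm (fun x => fderiv ℝ (iterDeriv k (fun i => 𝔢 (w' i)) v) x (𝔢 j)) 2 μ
        ≤ ENNReal.ofReal (n₁ * C_b) * ((𝔡 : ℝ≥0∞) * N₃) := mul_le_mul_of_nonneg_left hsum (zero_le)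
      _ ≤ (ENNReal.ofReal C_b * N₁) * ((𝔡 : ℝ≥0∞) * N₃) := by
          gcongr
          rw [mul_comm n₁]
          calc ENNReal.ofReal (C_b * n₁) ≤ ENNReal.ofReal C_b * N₁ := ofReal_mul_toReal_le C_b.coe_nonneg N₁
            _ = ENNReal.ofReal C_b * N₁ := rfl
      _ = (C_b * 𝔡 : ℝ≥0∞) * N₁ * N₃ := by
          rw [ENNReal.ofReal_coe_nnreal]; ring
  -- TYPE III bound: `A = D_{w'} v`, `|w'| ≤ 3`, `B = v`
  have typeIII : ∀ (k : ℕ) (hk : k ≤ 3) (w' : Fin k → Fin 𝔡),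
      eLpNorm (convect (iterDeriv k (fun i => 𝔢 (w' i)) v) v) 2 μ ≤ (C_b * 𝔡 : ℝ≥0∞) * N₁ * N₃ := by
    intro k hk w'
    have h := eLpNorm_convect_le_of_fderiv_apply_le (L := L) (A := iterDeriv k (fun i => 𝔢 (w' i)) v)
      hCb hsup1
    refine h.trans ?_
    calc ENNReal.ofReal (C_b * 𝔡 * n₁) * eLpNorm (iterDeriv k (fun i => 𝔢 (w' i)) v) 2 μ
        ≤ ENNReal.ofReal (C_b * 𝔡 * n₁) * N₃ := mul_le_mul_of_nonneg_left (hwordE k hk w') (zero_le)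
      _ ≤ (ENNReal.ofReal (C_b * 𝔡) * N₁) * N₃ := by
          gcongr
          exact ofReal_mul_toReal_le (by positivity) N₁
      _ = (C_b * 𝔡 : ℝ≥0∞) * N₁ * N₃ := by
          rw [ENNReal.ofReal_mul C_b.coe_nonneg, ENNReal.ofReal_coe_nnreal, ENNReal.ofReal_natCast]
  -- TYPE II bound: `A = ∂_b∂ₐ v`, `B = ∂_c v`
  have typeII : ∀ a b c : Fin 𝔡,
      eLpNorm (convect (fun x => fderiv ℝ (fun y => fderiv ℝ v y (𝔢 a)) x (𝔢 b))
        (fun x => fderiv ℝ v x (𝔢 c))) 2 μ ≤ (Kn : ℝ≥0∞) * N₁ * N₃ := by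
    intro a b c
    set S := convect (fun x => fderiv ℝ (fun y => fderiv ℝ v y (𝔢 a)) x (𝔢 b)) (fun x => fderiv ℝ v x (𝔢 c))
      with hS
    have hint := hK v hv hper n₁ n₃ hn₁0 hn₃0 hsup1 hword a b c
    -- `S ∈ L²(cell)`: it agrees on the cell with a function continuous on the closed cylinder
    set R1 := iterDerivWithin Kc 1 (fun i => 𝔢 (idxWord₁ c i)) v with hR1
    set R2 := iterDerivWithin Kc 2 (fun i => 𝔢 (idxWord₂ a b i)) v with hR2
    have hR1s : ContDiffOn ℝ ∞ R1 Kc := contDiffOn_iterDerivWithin hKu 1 _ hv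
    have hR2s : ContDiffOn ℝ ∞ R2 Kc := contDiffOn_iterDerivWithin hKu 2 _ hv
    have hR1eq : EqOn R1 (fun x => fderiv ℝ v x (𝔢 c)) U := fun x hx => by
      rw [hR1, iterDerivWithin_eqOn_iterDeriv hKu hU hUK 1 _ hv hx, iterDeriv_idxWord₁]
    have hR2eq : EqOn R2 (fun x => fderiv ℝ (fun y => fderiv ℝ v y (𝔢 a)) x (𝔢 b)) U := fun x hx => by
      rw [hR2, iterDerivWithin_eqOn_iterDeriv hKu hU hUK 2 _ hv hx, iterDeriv_idxWord₂]
    set SK : E³ → E³ := fun x => fderivWithin ℝ R1 Kc x (R2 x) with hSK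
    have hSKc : ContinuousOn SK Kc :=
      (hR1s.continuousOn_fderivWithin hKu (by exact_mod_cast le_top)).clm_apply hR2s.continuousOn
    have hSeq : EqOn S SK U := by
      intro x hx
      simp only [hS, convect_apply, hSK]
      have h1 : (fun x => fderiv ℝ v x (𝔢 c)) =ᶠ[𝓝 x] R1 :=
        (eventuallyEq_of_mem (hU.mem_nhds hx) hR1eq).symm
      rw [h1.fderiv_eq, fderivWithin_of_mem_nhds (hUK x hx), hR2eq hx]
    have hSK2 : MemLp SK 2 μ := memLp_cylinderCell_of_continuousOn_closure L 2 hSKc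
    have hS2 : MemLp S 2 μ :=
      hSK2.ae_eq (ae_restrict_of_forall_mem hΩm fun x hx => (hSeq (hΩU hx)).symm)
    have hb : 0 ≤ K * n₁ * n₃ := by positivity
    have h := eLpNorm_two_le_ofReal_of_integral_sq_le hS2 hb hint
    refine h.trans ?_
    calc ENNReal.ofReal (K * n₁ * n₃) ≤ ENNReal.ofReal (K * n₁) * N₃ := ofReal_mul_toReal_le (by positivity) N₃
      _ ≤ (ENNReal.ofReal K * N₁) * N₃ := by gcongr; exact ofReal_mul_toReal_le hK0 N₁
      _ = (Kn : ℝ≥0∞) * N₁ * N₃ := by rw [hKn, ENNReal.ofReal_eq_coe_nnreal hK0]; rfl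
  -- measurability of the products on the cell
  have meas : ∀ {a b : E³ → E³}, ContDiffOn ℝ ∞ a U → ContDiffOn ℝ ∞ b U →
      AEStronglyMeasurable (convect a b) μ := fun ha hb =>
    aestronglyMeasurable_cylinderCell_of_continuousOn L (continuousOn_convect ha hb)
  -- the basic unit bound `X = C_b 𝔡 N₁ N₃`, `Y = Kn N₁ N₃`
  set X : ℝ≥0∞ := (C_b * 𝔡 : ℝ≥0∞) * N₁ * N₃ with hX
  set Y : ℝ≥0∞ := (Kn : ℝ≥0∞) * N₁ * N₃ with hY
  have hfinal : 4 * X + 3 * Y ≤ ((4 * C_b * (𝔡 : ℝ≥0) + 3 * Kn + 1 : ℝ≥0) : ℝ≥0∞) * N₁ * N₃ := by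
    rw [hX, hY]
    push_cast
    have : (4 * (↑C_b * ↑𝔡) + 3 * ↑Kn : ℝ≥0∞) ≤ 4 * ↑C_b * ↑𝔡 + 3 * ↑Kn + 1 := by
      rw [mul_assoc]; exact le_self_add
    calc 4 * (↑C_b * ↑𝔡 * N₁ * N₃) + 3 * (↑Kn * N₁ * N₃) = (4 * (↑C_b * ↑𝔡) + 3 * ↑Kn) * N₁ * N₃ := by ring
      _ ≤ (4 * ↑C_b * ↑𝔡 + 3 * ↑Kn + 1) * N₁ * N₃ := by gcongr
  -- the word and its letters
  set u : Fin m → E³ := sobolevDir w with hu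
  have hcc : convectionCommutator m w v = convectCommutator m u v v := rfl
  rw [hcc]
  -- case analysis on the length
  rcases Nat.lt_or_ge m 1 with hm0 | hm1
  · -- `m = 0`
    obtain rfl : m = 0 := by omega
    rw [convectCommutator_zero]
    simp
  rcases Nat.lt_or_ge m 2 with hm1' | hm2
  · -- `m = 1`
    obtain rfl : m = 1 := by omega
    have hone := convectCommutator_one_eqOn hU u hvU hvU
    rw [eLpNorm_cylinderCell_congr hone]
    have hu0 : u 0 = 𝔢 (w 0) := rfl
    simp only [hu0, e1]
    calc eLpNorm (convect (iterDeriv 1 (fun i => 𝔢 (idxWord₁ (w 0) i)) v) v) 2 μ ≤ X := typeIII 1 (by norm_num) _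
      _ = 1 * X := (one_mul X).symm
      _ ≤ 4 * X := mul_le_mul_of_nonneg_right (by norm_num) (zero_le)
      _ ≤ 4 * X + 3 * Y := le_self_add
      _ ≤ _ := hfinal
  rcases Nat.lt_or_ge m 3 with hm2' | hm3
  · -- `m = 2`
    obtain rfl : m = 2 := by omega
    have hu0 : u 0 = 𝔢 (w 0) := rfl
    have ht0 : Fin.tail u 0 = 𝔢 (w 1) := rfl
    -- the recursion, twice
    have hrec := convectCommutator_succ_eqOn hU 1 u hvU hvU
    set a' : E³ → E³ := fun y => fderiv ℝ v y (u 0) with ha'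
    have ha's : ContDiffOn ℝ ∞ a' U := by rw [ha', hu0]; exact hsm1 _
    have h1 := convectCommutator_one_eqOn hU (Fin.tail u) ha's hvU
    have h2 := convectCommutator_one_eqOn hU (Fin.tail u) hvU ha's
    set T₁ := convect a' (iterDeriv 1 (Fin.tail u) v) with hT₁
    set T₂ := convect (fun y => fderiv ℝ a' y (Fin.tail u 0)) v with hT₂
    set T₃ := convect (fun y => fderiv ℝ v y (Fin.tail u 0)) a' with hT₃
    have hsumeq : EqOn (convectCommutator 2 u v v) (T₁ + T₂ + T₃) U := by
      intro x hx
      have E0 := hrec hx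
      have E1 := h1 hx
      have E2 := h2 hx
      rw [E0]
      try dsimp only
      rw [E1, E2]
      simp only [Pi.add_apply, hT₁, hT₂, hT₃]
    rw [eLpNorm_cylinderCell_congr hsumeq]
    -- measurability
    have htail : iterDeriv 1 (Fin.tail u) v = fun x => fderiv ℝ v x (𝔢 (w 1)) := by
      rw [iterDeriv_succ, iterDeriv_zero, ht0]
    have mT₁ : AEStronglyMeasurable T₁ μ := meas ha's (by rw [htail]; exact hsm1 _)
    have mT₂ : AEStronglyMeasurable T₂ μ := meas (by rw [ht0, ha', hu0]; exact hsm2 _ _) hvU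
    have mT₃ : AEStronglyMeasurable T₃ μ := meas (by rw [ht0]; exact hsm1 _) ha's
    -- bounds
    have bT₁ : eLpNorm T₁ 2 μ ≤ X := by
      rw [hT₁, ha', hu0, htail, e1 (w 1)]
      exact typeI (w 0) 1 (by norm_num) _
    have bT₂ : eLpNorm T₂ 2 μ ≤ X := by
      rw [hT₂, ht0, ha', hu0, e2 (w 0) (w 1)]
      exact typeIII 2 (by norm_num) _
    have bT₃ : eLpNorm T₃ 2 μ ≤ X := by
      rw [hT₃, ht0, ha', hu0, e1 (w 0)]
      exact typeI (w 1) 1 (by norm_num) _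
    calc eLpNorm (T₁ + T₂ + T₃) 2 μ ≤ eLpNorm (T₁ + T₂) 2 μ + eLpNorm T₃ 2 μ := eLpNorm_add_le (mT₁.add mT₂) mT₃ one_le_two
      _ ≤ (eLpNorm T₁ 2 μ + eLpNorm T₂ 2 μ) + eLpNorm T₃ 2 μ := by
          gcongr; exact eLpNorm_add_le mT₁ mT₂ one_le_two
      _ ≤ X + X + X := add_le_add (add_le_add bT₁ bT₂) bT₃
      _ ≤ 4 * X + 3 * Y := by
          calc X + X + X = 3 * X := by ring
            _ ≤ 4 * X := mul_le_mul_of_nonneg_right (by norm_num) (zero_le)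
            _ ≤ 4 * X + 3 * Y := le_self_add
      _ ≤ _ := hfinal
  · -- `m = 3`
    obtain rfl : m = 3 := by omega
    have hu0 : u 0 = 𝔢 (w 0) := rfl
    have ht0 : Fin.tail u 0 = 𝔢 (w 1) := rfl
    have htt0 : Fin.tail (Fin.tail u) 0 = 𝔢 (w 2) := rfl
    -- first level (stated before the abbreviations, which then fold into it)
    have hrec := convectCommutator_succ_eqOn hU 2 u hvU hvU
    set t := Fin.tail u with ht
    set a' : E³ → E³ := fun y => fderiv ℝ v y (u 0) with ha'
    have ha's : ContDiffOn ℝ ∞ a' U := by rw [ha', hu0]; exact hsm1 _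
    -- second level, for `(a', v)` and `(v, a')`
    have hrec1 := convectCommutator_succ_eqOn hU 1 t ha's hvU
    have hrec2 := convectCommutator_succ_eqOn hU 1 t hvU ha's
    set a'' : E³ → E³ := fun y => fderiv ℝ a' y (t 0) with ha''
    set v' : E³ → E³ := fun y => fderiv ℝ v y (t 0) with hv'
    have ha''s : ContDiffOn ℝ ∞ a'' U := by rw [ha'', ht0, ha', hu0]; exact hsm2 _ _
    have hv's : ContDiffOn ℝ ∞ v' U := by rw [hv', ht0]; exact hsm1 _
    -- third level: one-letter commutators along `tail t`
    have h11 := convectCommutator_one_eqOn hU (Fin.tail t) ha''s hvU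
    have h12 := convectCommutator_one_eqOn hU (Fin.tail t) ha's hv's
    have h21 := convectCommutator_one_eqOn hU (Fin.tail t) hv's ha's
    have h22 := convectCommutator_one_eqOn hU (Fin.tail t) hvU ha''s
    -- the seven terms
    set S₁ := convect a' (iterDeriv 2 t v) with hS₁
    set S₂ := convect a'' (iterDeriv 1 (Fin.tail t) v) with hS₂
    set S₃ := convect (fun y => fderiv ℝ a'' y (Fin.tail t 0)) v with hS₃
    set S₄ := convect (fun y => fderiv ℝ a' y (Fin.tail t 0)) v' with hS₄
    set S₅ := convect v' (iterDeriv 1 (Fin.tail t) a') with hS₅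
    set S₆ := convect (fun y => fderiv ℝ v' y (Fin.tail t 0)) a' with hS₆
    set S₇ := convect (fun y => fderiv ℝ v y (Fin.tail t 0)) a'' with hS₇
    have hsumeq : EqOn (convectCommutator 3 u v v) (S₁ + S₂ + S₃ + S₄ + S₅ + S₆ + S₇) U := by
      intro x hx
      have E0 := hrec hx
      have E1 := hrec1 hx
      have E2 := hrec2 hx
      have E11 := h11 hx
      have E12 := h12 hx
      have E21 := h21 hx
      have E22 := h22 hx
      rw [E0]
      try dsimp only
      rw [E1, E2]
      try dsimp only
      rw [E11, E12, E21, E22]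
      simp only [Pi.add_apply]
      abel
    rw [eLpNorm_cylinderCell_congr hsumeq]
    -- rewriting the pieces as nested basis derivatives
    have htl1 : iterDeriv 1 (Fin.tail t) v = fun x => fderiv ℝ v x (𝔢 (w 2)) := by
      rw [iterDeriv_succ, iterDeriv_zero, htt0]
    have htl1' : iterDeriv 1 (Fin.tail t) a' = fun x => fderiv ℝ (fun y => fderiv ℝ v y (𝔢 (w 0))) x (𝔢 (w 2)) := by
      rw [iterDeriv_succ, iterDeriv_zero, htt0, ha', hu0]
    have ht2 : iterDeriv 2 t v = iterDeriv 2 (fun i => 𝔢 (Fin.tail w i)) v := rfl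
    -- measurability
    have mS₁ : AEStronglyMeasurable S₁ μ := meas ha's (hsm 2 _)
    have mS₂ : AEStronglyMeasurable S₂ μ := meas ha''s (by rw [htl1]; exact hsm1 _)
    have mS₃ : AEStronglyMeasurable S₃ μ :=
      meas (by rw [htt0, ha'', ht0, ha', hu0]; exact hsm3 _ _ _) hvU
    have mS₄ : AEStronglyMeasurable S₄ μ := meas (by rw [htt0, ha', hu0]; exact hsm2 _ _) hv's
    have mS₅ : AEStronglyMeasurable S₅ μ := meas hv's (by rw [htl1']; exact hsm2 _ _)
    have mS₆ : AEStronglyMeasurable S₆ μ := meas (by rw [htt0, hv', ht0]; exact hsm2 _ _) ha's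
    have mS₇ : AEStronglyMeasurable S₇ μ := meas (by rw [htt0]; exact hsm1 _) ha''s
    -- bounds
    have bS₁ : eLpNorm S₁ 2 μ ≤ X := by
      rw [hS₁, ha', hu0, ht2]
      exact typeI (w 0) 2 le_rfl _
    have bS₂ : eLpNorm S₂ 2 μ ≤ Y := by
      rw [hS₂, htl1, ha'', ht0, ha', hu0]
      exact typeII (w 0) (w 1) (w 2)
    have bS₃ : eLpNorm S₃ 2 μ ≤ X := by
      rw [hS₃, htt0, ha'', ht0, ha', hu0, e3 (w 0) (w 1) (w 2)]
      exact typeIII 3 le_rfl _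
    have bS₄ : eLpNorm S₄ 2 μ ≤ Y := by
      rw [hS₄, htt0, ha', hu0, hv', ht0]
      exact typeII (w 0) (w 2) (w 1)
    have bS₅ : eLpNorm S₅ 2 μ ≤ X := by
      rw [hS₅, htl1', hv', ht0, e2 (w 0) (w 2)]
      exact typeI (w 1) 2 le_rfl _
    have bS₆ : eLpNorm S₆ 2 μ ≤ Y := by
      rw [hS₆, htt0, hv', ht0, ha', hu0]
      exact typeII (w 1) (w 2) (w 0)
    have bS₇ : eLpNorm S₇ 2 μ ≤ X := by
      rw [hS₇, htt0, ha'', ht0, ha', hu0, e2 (w 0) (w 1)]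
      exact typeI (w 2) 2 le_rfl _
    -- Minkowski, six times
    have m12 := mS₁.add mS₂
    have m123 := m12.add mS₃
    have m1234 := m123.add mS₄
    have m12345 := m1234.add mS₅
    have m123456 := m12345.add mS₆
    calc eLpNorm (S₁ + S₂ + S₃ + S₄ + S₅ + S₆ + S₇) 2 μ
        ≤ eLpNorm S₁ 2 μ + eLpNorm S₂ 2 μ + eLpNorm S₃ 2 μ + eLpNorm S₄ 2 μ + eLpNorm S₅ 2 μ +
            eLpNorm S₆ 2 μ + eLpNorm S₇ 2 μ := by
          refine (eLpNorm_add_le m123456 mS₇ one_le_two).trans (add_le_add ?_ le_rfl)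
          refine (eLpNorm_add_le m12345 mS₆ one_le_two).trans (add_le_add ?_ le_rfl)
          refine (eLpNorm_add_le m1234 mS₅ one_le_two).trans (add_le_add ?_ le_rfl)
          refine (eLpNorm_add_le m123 mS₄ one_le_two).trans (add_le_add ?_ le_rfl)
          refine (eLpNorm_add_le m12 mS₃ one_le_two).trans (add_le_add ?_ le_rfl)
          exact eLpNorm_add_le mS₁ mS₂ one_le_two
      _ ≤ X + Y + X + Y + X + Y + X :=
          add_le_add (add_le_add (add_le_add (add_le_add (add_le_add (add_le_add bS₁ bS₂) bS₃) bS₄) bS₅) bS₆) bS₇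
      _ = 4 * X + 3 * Y := by ring
      _ ≤ _ := hfinal

end Literature.Analysis.FluidPDE
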